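import Summits.ValiantsHypothesis.ValiantsHypothesis.Theses.ProofCarryingSymmetry
import Literature.Computability.AlgebraicComplexity.DawarWilsenach2025Thm71

/-!
# `ProofCarryingSymmetry.SquareSymmetricPermLB` (crux stmt-ValiantsHypothesis-10342) — line `registered`
(= birth skeleton `Lines/birth.lean`), lead's copy with ALL THREE STUBS FILLED (sorry-free).

Crux BY NAME: `Summit.ValiantsHypothesis.ValiantsHypothesis.Theses.ProofCarryingSymmetry.SquareSymmetricPermLB`
— Dawar–Wilsenach 2025 Thm 7.1 in SIZE form at `F = ℂ`.

LINE = the printed deduction of Thm 7.1 (ToC 21(14) 2025, p. 19) from Thm 5.1 (arithmetic → threshold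
translation), Thm 6.4 (orbit size `2^{o(n)}` ⇒ counting width `o(n)`), Thm 7.2 (CFI matching graphs).
The three registered stubs are stated verbatim as registered and are each closed by `exact` the landed
Literature theorem:

* `stub_thresholdTranslation` := `Literature.Computability.AlgebraicComplexity.DawarWilsenach2025_thm51_family`
* `stub_orbitSizeCountingWidth` := `Literature.ModelTheory.FiniteModelTheory.DawarWilsenach2025_orbitSize_countingWidth_holds`
* `stub_cfiMatchings` := `Literature.ModelTheory.FiniteModelTheory.CFIMatching.DawarWilsenach2025_thm72_family`

ASSEMBLY `SquareSymmetricPermLB_of_hyps` = the tree's `DawarWilsenach2025_thm71_of_thm51_thm64_thm72`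
followed by `DawarWilsenach2025_thm71.size_form` at `ℂ`; `SquareSymmetricPermLB_of` concludes the crux by
name. The closing Theorems file (`Theorems/ProofCarryingSymmetrySquareSymmetricPermLB.lean`) uses the
equivalent one-liner through `DawarWilsenach2025_thm71_holds`.

Disproof used: none exists for this crux (no `Disproof.lean`; refuter verdict "survives").
-/

namespace Summit.ValiantsHypothesis.ValiantsHypothesis.Cruxes.SquareSymmetricPermLB.Birth

open Filter
open Literature.Computability.AlgebraicComplexity
open Literature.ModelTheory.FiniteModelTheory
open Literature.Computability.Complexity (Circuit tcBasis)

-- `Summit.ValiantsHypothesis.ValiantsHypothesis.…` is the tree's mandated single-conjunct layout (Sub = Summit).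
set_option linter.dupNamespace false

/-! ## §1 The three registered stubs (signatures verbatim as registered; all closed) -/

/-- **stub 1 — Dawar–Wilsenach Thm 5.1 (arithmetic → threshold, symmetry- and orbit-size-preserving),
family form.** Closed by the landed `DawarWilsenach2025_thm51_family`.
[cite: DawarWilsenach2025, Thm. 5.1 (pp. 13–16)] -/
theorem stub_thresholdTranslation :
    ∀ (F : Type) [Field F] [CharZero F] (G : ℕ → Type) [∀ n, Fintype (G n)]
      (Φ : ∀ n, LabelledArithCircuit F (Fin n × Fin n) Unit (G n)) (S : ℕ → Set F),
      (∀ n, (Φ n).IsSymmetric (Equiv.Perm (Fin n))) → (∀ n, (S n).Finite) →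
      (∀ ε : ℝ, 0 < ε → ∀ᶠ n : ℕ in atTop,
        ((Φ n).orbitSize (Equiv.Perm (Fin n)) : ℝ) ≤ (2 : ℝ) ^ (ε * (n : ℝ))) →
      ∃ Ψ : ∀ n, Circuit (Fin n × Fin n),
        (∀ n, (Ψ n).IsOver tcBasis ∧ (Ψ n).IsSymmetricUnder Set.univ ∧ (Ψ n).HasSimpleWiring) ∧
        (∀ ε : ℝ, 0 < ε → ∀ᶠ n : ℕ in atTop,
          ((Ψ n).orbitSize Set.univ : ℝ) ≤ (2 : ℝ) ^ (ε * (n : ℝ))) ∧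
        ∀ (n : ℕ) (A : Fin n × Fin n → Bool), (Ψ n).eval A = true ↔
          MvPolynomial.eval (fun ij => if A ij = true then (1 : F) else 0)
            ((Φ n).eval ((Φ n).output ())) ∈ S n :=
  DawarWilsenach2025_thm51_family

/-- **stub 2 — Dawar–Wilsenach Thm 6.4 (orbit size `2^{o(n)}` ⇒ counting width `o(n)`).** Verbatim the
body of the named fact `DawarWilsenach2025_orbitSize_countingWidth`; closed by the landed
`DawarWilsenach2025_orbitSize_countingWidth_holds`. [cite: DawarWilsenach2025, Thm. 6.4 (p. 17)] -/
theorem stub_orbitSizeCountingWidth :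
    ∀ (𝒞 : Set FinGraph) (C : ∀ n : ℕ, Circuit (Fin n × Fin n)),
      (∀ n, (C n).IsOver tcBasis ∧ (C n).IsSymmetricUnder Set.univ ∧ (C n).HasSimpleWiring) →
      DecidesGraphClass 𝒞 C →
      (∀ ε : ℝ, 0 < ε → ∀ᶠ n : ℕ in atTop, ((C n).orbitSize Set.univ : ℝ) ≤ (2 : ℝ) ^ (ε * (n : ℝ))) →
      ∀ ε : ℝ, 0 < ε → ∀ᶠ n : ℕ in atTop, ∀ k : ℕ, ε * (n : ℝ) ≤ (k : ℝ) → IsCkInvariantAt 𝒞 n k :=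
  DawarWilsenach2025_orbitSize_countingWidth_holds

/-- **stub 3 — Dawar–Wilsenach Thm 7.2 (CFI matching graphs), family form.** Closed by the landed
`CFIMatching.DawarWilsenach2025_thm72_family`. [cite: DawarWilsenach2025, Thm. 7.2 (pp. 19–24)] -/
theorem stub_cfiMatchings :
    ∃ c : ℕ, ∀ k : ℕ, ∃ m : ℕ, m ≤ c * k + c ∧ ∃ X Y : SimpleGraph (Fin m),
      (∃ s t : Set (Fin m), X.IsBipartiteWith s t ∧ s ∪ t = Set.univ) ∧
      (∃ s t : Set (Fin m), Y.IsBipartiteWith s t ∧ s ∪ t = Set.univ) ∧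
      CkEquiv k X Y ∧
      Nat.card {M : X.Subgraph // M.IsPerfectMatching} ≠
        Nat.card {M : Y.Subgraph // M.IsPerfectMatching} :=
  CFIMatching.DawarWilsenach2025_thm72_family

/-! ## §2 Assembly (sorry-free) and the skeleton theorem (crux by name) -/

/-- **Assembly with the stubs as explicit hypotheses: stub 1 → stub 2 → stub 3 → the crux statement**
(verbatim the body of `ProofCarryingSymmetry.SquareSymmetricPermLB`): the tree's
`DawarWilsenach2025_thm71_of_thm51_thm64_thm72` (orbit-size form, every characteristic-`0` field)
followed by the size corollary `DawarWilsenach2025_thm71.size_form` (`ORB(C) ≤ |C|`) at `F = ℂ`.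
[cite: DawarWilsenach2025, §7.1 (proof of Thm. 7.1, p. 19)] -/
theorem SquareSymmetricPermLB_of_hyps :
    (∀ (F : Type) [Field F] [CharZero F] (G : ℕ → Type) [∀ n, Fintype (G n)]
      (Φ : ∀ n, LabelledArithCircuit F (Fin n × Fin n) Unit (G n)) (S : ℕ → Set F),
      (∀ n, (Φ n).IsSymmetric (Equiv.Perm (Fin n))) → (∀ n, (S n).Finite) →
      (∀ ε : ℝ, 0 < ε → ∀ᶠ n : ℕ in atTop,
        ((Φ n).orbitSize (Equiv.Perm (Fin n)) : ℝ) ≤ (2 : ℝ) ^ (ε * (n : ℝ))) →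
      ∃ Ψ : ∀ n, Circuit (Fin n × Fin n),
        (∀ n, (Ψ n).IsOver tcBasis ∧ (Ψ n).IsSymmetricUnder Set.univ ∧ (Ψ n).HasSimpleWiring) ∧
        (∀ ε : ℝ, 0 < ε → ∀ᶠ n : ℕ in atTop,
          ((Ψ n).orbitSize Set.univ : ℝ) ≤ (2 : ℝ) ^ (ε * (n : ℝ))) ∧
        ∀ (n : ℕ) (A : Fin n × Fin n → Bool), (Ψ n).eval A = true ↔
          MvPolynomial.eval (fun ij => if A ij = true then (1 : F) else 0)
            ((Φ n).eval ((Φ n).output ())) ∈ S n) →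
    (∀ (𝒞 : Set FinGraph) (C : ∀ n : ℕ, Circuit (Fin n × Fin n)),
      (∀ n, (C n).IsOver tcBasis ∧ (C n).IsSymmetricUnder Set.univ ∧ (C n).HasSimpleWiring) →
      DecidesGraphClass 𝒞 C →
      (∀ ε : ℝ, 0 < ε → ∀ᶠ n : ℕ in atTop, ((C n).orbitSize Set.univ : ℝ) ≤ (2 : ℝ) ^ (ε * (n : ℝ))) →
      ∀ ε : ℝ, 0 < ε → ∀ᶠ n : ℕ in atTop, ∀ k : ℕ, ε * (n : ℝ) ≤ (k : ℝ) → IsCkInvariantAt 𝒞 n k) →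
    (∃ c : ℕ, ∀ k : ℕ, ∃ m : ℕ, m ≤ c * k + c ∧ ∃ X Y : SimpleGraph (Fin m),
      (∃ s t : Set (Fin m), X.IsBipartiteWith s t ∧ s ∪ t = Set.univ) ∧
      (∃ s t : Set (Fin m), Y.IsBipartiteWith s t ∧ s ∪ t = Set.univ) ∧
      CkEquiv k X Y ∧
      Nat.card {M : X.Subgraph // M.IsPerfectMatching} ≠
        Nat.card {M : Y.Subgraph // M.IsPerfectMatching}) →
      ∀ (G : ℕ → Type) [∀ n, Fintype (G n)]
        (C : ∀ n, LabelledArithCircuit ℂ (Fin n × Fin n) Unit (G n)),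
        (∀ n, (C n).IsSymmetric (Equiv.Perm (Fin n))) →
        (∀ n, (C n).eval ((C n).output ()) = perPoly (Fin n) ℂ) →
        ∃ ε : ℝ, 0 < ε ∧ ∀ n₀ : ℕ, ∃ n ≥ n₀, (2 : ℝ) ^ (ε * n) ≤ Fintype.card (G n) :=
  fun h51 h64 h72 G _ C hs hp =>
    (DawarWilsenach2025_thm71_of_thm51_thm64_thm72 h51 h64 h72).size_form ℂ G C hs hp

/-- **Skeleton theorem: the crux BY NAME from the three registered stubs** (now sorry-free end to end).
[cite: DawarWilsenach2025, Thm. 7.1 (p. 18)] -/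
theorem SquareSymmetricPermLB_of :
    Summit.ValiantsHypothesis.ValiantsHypothesis.Theses.ProofCarryingSymmetry.SquareSymmetricPermLB :=
  SquareSymmetricPermLB_of_hyps stub_thresholdTranslation stub_orbitSizeCountingWidth stub_cfiMatchings

end Summit.ValiantsHypothesis.ValiantsHypothesis.Cruxes.SquareSymmetricPermLB.Birth
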